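import Literature.MathematicalPhysics.QuantumFieldTheory.Balaban1983to89.Node00.Record12CarriersB12
import Literature.MathematicalPhysics.QuantumFieldTheory.Balaban1983to89.Node00.Record12CarriersB12Package

/-!
# NODE 00 (YM-PLAN Track A) — STAGE 3′(X.B12) COMPANION AT STAGE 12, II: THE PROVISO-CARRYING RECORDS `IsRecordOfRecord₁₂CB10YZWB8B12Prov` ∕ `…B8subB12Prov` MAPPED BY NAME INTO
# g32's SIX-PIN RECORDS `IsRecordOfRecord₁₂CB10YZWB8B12` ∕ `…B8subB12` (SAME datum, SAME world), AND ON TO def-T's `IsRecordOfRecord₁₂C` (same datum, companion world)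

NODE 00 COMPANION MODULE (seat `pub-ymgap-node00-def-B12`, 2026-08-26; sequel of `Node00/Record12CarriersB12Package`).  APPEND-ONLY: a NEW importing module over node00-def's
`Node00/Record12CarriersB12` (C3) and this seat's `Node00/Record12CarriersB12Package`; everything is CONSUMED BY NAME.  WHAT IS PROVED (kernel bookkeeping, 0 sorry, 0 def):
`isRecordOfRecord₁₂CB10YZWB8B12_of_isRecordOfRecord₁₂CB10YZWB8B12Prov` ∕ `isRecordOfRecord₁₂CB10YZWB8subB12_of_…Prov` (forget the provisos: g32's record, SAME `D`, SAME `w` —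
the clauses are verbatim, so the proof is the six-slot presentation of the first module), `isRecordOfRecord₁₂CB10YZWB8_of_…B8B12Prov` (one more forgetful step, g32's map),
`exists_isRecordOfRecord₁₂C_of_…B8B12Prov` ∕ `…_of_…B8subB12Prov` (def-T's `₁₂C` record with the SAME datum at g32's companion world, leaves equal except `b8`).
STATUS (ref-C NOTE-2 (c)(iii)): the `…Prov` predicates are PROVISO-CARRYING SUCCESSOR records — every closer over them is GAP-STATED(package) BY CONSTRUCTION and count-neutral, and
they are NOT the world of record (N09's count line lives at def-T's `IsRecordOfRecord₁₂C`).  HONEST FRAMING: kernel bookkeeping; NO estimate; nothing of [Balaban1987RG1] asserted;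
N09 NOT discharged; counts unmoved; one finite T⁴ programme at fixed ε, Bałaban as printed — NOT continuum ∕ ℝ⁴ ∕ infinite volume ∕ OS ∕ mass gap ∕ Clay.  No `sorry`, no `axiom`,
no `instance`, no `notation`.  [Balaban1987RG1] = T. Bałaban, Commun. Math. Phys. **109** (1987) 249–301; [Balaban1989LargeFieldII] = Commun. Math. Phys. **122** (1989) 355–392. -/

noncomputable section

namespace Literature.MathematicalPhysics.QuantumFieldTheory.Balaban1983to89.Node00

open T4Continuum AveragingRT T4FiniteEpsInhabited FlowStep FlowStepRuns DagBinding T4DatumAssembly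

section ProvToSixPin

variable {F : T4Family} {N : ℕ} [NeZero N] {D : FiniteEpsData F (SU N)} {w : WorldP}

/-- **FORGET THE PROVISOS**: a proviso-carrying record is g32's six-pin record `IsRecordOfRecord₁₂CB10YZWB8B12` with the SAME datum and the SAME world (clauses verbatim).
STATUS (ref-C NOTE-2 (c)(iii)): PROVISO-CARRYING SUCCESSOR record — GAP-STATED(package) by construction, count-neutral, NOT the world of record.
[cite: Balaban1989LargeFieldII, Thm 1 + (0.1) pp.355–356 (bookkeeping)] -/
theorem isRecordOfRecord₁₂CB10YZWB8B12_of_isRecordOfRecord₁₂CB10YZWB8B12Prov (hR : IsRecordOfRecord₁₂CB10YZWB8B12Prov F N D w) :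
    IsRecordOfRecord₁₂CB10YZWB8B12 F N D w :=
  sixSlot_of_isRecordOfRecord₁₂CB10YZWB8B12Prov hR

/-- … and hence g31∕g32's five-pin record `IsRecordOfRecord₁₂CB10YZWB8` (same datum, same world; g32's `isRecordOfRecord₁₂CB10YZWB8_of_isRecordOfRecord₁₂CB10YZWB8B12`).
STATUS as above. [cite: Balaban1989LargeFieldII, Thm 1 + (0.1) pp.355–356 (bookkeeping)] -/
theorem isRecordOfRecord₁₂CB10YZWB8_of_isRecordOfRecord₁₂CB10YZWB8B12Prov (hR : IsRecordOfRecord₁₂CB10YZWB8B12Prov F N D w) :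
    IsRecordOfRecord₁₂CB10YZWB8 F N D w :=
  isRecordOfRecord₁₂CB10YZWB8_of_isRecordOfRecord₁₂CB10YZWB8B12 (isRecordOfRecord₁₂CB10YZWB8B12_of_isRecordOfRecord₁₂CB10YZWB8B12Prov hR)

/-- **ON TO THE WORLD OF RECORD'S PREDICATE**: def-T's `IsRecordOfRecord₁₂C` holds with the SAME datum at g32's companion world `w′` (same `C`, `γ`, `L`; leaves equal except `b8`) —
g32's `exists_isRecordOfRecord₁₂C_of_isRecordOfRecord₁₂CB10YZWB8B12` after forgetting the provisos.  STATUS as above; the `₁₂C` record at `w′` does NOT remember the package.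
[cite: Balaban1989LargeFieldII, Thm 1 + (0.1) pp.355–356 (bookkeeping)] -/
theorem exists_isRecordOfRecord₁₂C_of_isRecordOfRecord₁₂CB10YZWB8B12Prov (hR : IsRecordOfRecord₁₂CB10YZWB8B12Prov F N D w) :
    ∃ w' : WorldP, IsRecordOfRecord₁₂C F N D w' ∧ w'.C = w.C ∧ w'.γ = w.γ ∧ w'.L = w.L ∧
      (∀ P : B12.RunParams, leavesP w P = { leavesP w' P with b8 := (leavesP w P).b8 }) :=
  exists_isRecordOfRecord₁₂C_of_isRecordOfRecord₁₂CB10YZWB8B12 (isRecordOfRecord₁₂CB10YZWB8B12_of_isRecordOfRecord₁₂CB10YZWB8B12Prov hR)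

/-- **FORGET THE PROVISOS ([B8′] view)**: a proviso-carrying record over the six-pin view with [B8′] is g32's `IsRecordOfRecord₁₂CB10YZWB8subB12` with the SAME datum and the SAME
world (clauses verbatim).  STATUS as above. [cite: Balaban1989LargeFieldII, Thm 1 + (0.1) pp.355–356 (bookkeeping)] -/
theorem isRecordOfRecord₁₂CB10YZWB8subB12_of_isRecordOfRecord₁₂CB10YZWB8subB12Prov (hR : IsRecordOfRecord₁₂CB10YZWB8subB12Prov F N D w) :
    IsRecordOfRecord₁₂CB10YZWB8subB12 F N D w :=
  sixSlot_of_isRecordOfRecord₁₂CB10YZWB8subB12Prov hR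

/-- … and def-T's `IsRecordOfRecord₁₂C` with the SAME datum at g32's companion world (g32's `exists_isRecordOfRecord₁₂C_of_isRecordOfRecord₁₂CB10YZWB8subB12`).  STATUS as above.
[cite: Balaban1989LargeFieldII, Thm 1 + (0.1) pp.355–356 (bookkeeping)] -/
theorem exists_isRecordOfRecord₁₂C_of_isRecordOfRecord₁₂CB10YZWB8subB12Prov (hR : IsRecordOfRecord₁₂CB10YZWB8subB12Prov F N D w) :
    ∃ w' : WorldP, IsRecordOfRecord₁₂C F N D w' ∧ w'.C = w.C ∧ w'.γ = w.γ ∧ w'.L = w.L ∧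
      (∀ P : B12.RunParams, leavesP w P = { leavesP w' P with b8 := (leavesP w P).b8 }) :=
  exists_isRecordOfRecord₁₂C_of_isRecordOfRecord₁₂CB10YZWB8subB12 (isRecordOfRecord₁₂CB10YZWB8subB12_of_isRecordOfRecord₁₂CB10YZWB8subB12Prov hR)

end ProvToSixPin

end Literature.MathematicalPhysics.QuantumFieldTheory.Balaban1983to89.Node00

end
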